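import Summits.CriticalPhenomena.SAWScalingLimit.Theorems.SAWLeftRightFKGFKGToTraversalBoundDomainMarkov
import HarnessLib

/-!
# Gate excision, part 2: first/last visit decomposition and path surgery (walk combinatorics)

Crux `SAWLeftRightFKG.FKGToTraversalBound` (stmt-CriticalPhenomena-1878), line
`gates-by-bubble-doors-by-fkg`, registered helper `gateExcision_walkDecomp` of the stub
`stub_gateExcision` (the gate lemma `CriticalBubbleBound → ∀ w₀, GatedPocketBound w₀`).

Pure combinatorics of walks of a simple graph `G` relative to a vertex set `T` (the THROAT):

* `exists_firstVisit` — a walk `p : u → v` meeting `T` splits as `p = P · Q` at its FIRST visit `t ∈ T`,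
  and every vertex of `P` other than `t` is joined to `u` by a walk avoiding `T` (a prefix of `P`);
* `gateExcision_walkDecomp` — the two-sided form `p = P · M · S` at the first visit `t₁` and the last
  visit `t₂` (first visit of `p.reverse`): vertices of `P ∖ {t₁}` are joined to `u` off `T`, vertices of
  `S ∖ {t₂}` are joined to `v` off `T`;
* `takeUntil_end_of_isPath`, `append_inj_of_isPath` — a self-avoiding prefix `P : u → t` of a walk
  `P · Q` is determined by the walk (it is `takeUntil t`), the bookkeeping behind the injectivity of the
  excision map `P · M · S ↦ (P · R · S, M)` of the gate lemma.

Only theorems; no named fact; axioms are the standard three.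
-/

namespace Summit.CriticalPhenomena.SAWScalingLimit.Theorems.FKGToTraversalBound.GatesByBubbleDoorsByFKG

open Summit.CriticalPhenomena.SAWScalingLimit.Theorems.FKGToTraversalBound.ExcursionDomination
  (append_left_cancel)

variable {V : Type*} {G : SimpleGraph V}

/-! ### First-visit decomposition -/

/-- **First visit.**  A walk `p : u → v` with a vertex in `T` splits as `p = P · Q` with `P : u → t`,
`t ∈ T`, such that every vertex `y ≠ t` of `P` is joined to `u` by a walk all of whose vertices lie
off `T` (namely the piece of `P` before `y`).  Induction on `p`. [folklore] -/
theorem exists_firstVisit (T : Set V) :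
    ∀ {u v : V} (p : G.Walk u v), (∃ y ∈ p.support, y ∈ T) →
      ∃ (t : V) (P : G.Walk u t) (Q : G.Walk t v), t ∈ T ∧ p = P.append Q ∧
        ∀ y ∈ P.support, y ≠ t → ∃ r : G.Walk u y, ∀ z ∈ r.support, z ∉ T := by
  classical
  intro u v p
  induction p with
  | nil =>
    rintro ⟨y, hy, hyT⟩
    rw [SimpleGraph.Walk.support_nil, List.mem_singleton] at hy
    subst hy
    refine ⟨y, SimpleGraph.Walk.nil, SimpleGraph.Walk.nil, hyT, rfl, fun z hz hne => ?_⟩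
    rw [SimpleGraph.Walk.support_nil, List.mem_singleton] at hz
    exact absurd hz hne
  | cons h p ih =>
    rename_i u' v' w'
    rintro ⟨y, hy, hyT⟩
    by_cases hu : u' ∈ T
    · refine ⟨u', SimpleGraph.Walk.nil, SimpleGraph.Walk.cons h p, hu, rfl, fun z hz hne => ?_⟩
      rw [SimpleGraph.Walk.support_nil, List.mem_singleton] at hz
      exact absurd hz hne
    · have hy' : ∃ y ∈ p.support, y ∈ T := by
        rw [SimpleGraph.Walk.support_cons, List.mem_cons] at hy
        rcases hy with rfl | hy
        · exact absurd hyT hu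
        · exact ⟨y, hy, hyT⟩
      obtain ⟨t, P, Q, ht, hpq, hP⟩ := ih hy'
      refine ⟨t, SimpleGraph.Walk.cons h P, Q, ht, by rw [hpq, SimpleGraph.Walk.cons_append], ?_⟩
      intro z hz hne
      rw [SimpleGraph.Walk.support_cons, List.mem_cons] at hz
      rcases hz with rfl | hz
      · refine ⟨SimpleGraph.Walk.nil, fun x hx => ?_⟩
        rw [SimpleGraph.Walk.support_nil, List.mem_singleton] at hx
        exact hx ▸ hu
      · obtain ⟨r, hr⟩ := hP z hz hne
        refine ⟨SimpleGraph.Walk.cons h r, fun x hx => ?_⟩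
        rw [SimpleGraph.Walk.support_cons, List.mem_cons] at hx
        rcases hx with rfl | hx
        · exact hu
        · exact hr x hx

/-- **Registered helper `gateExcision_walkDecomp`** (crux stmt-CriticalPhenomena-1878, stub
`stub_gateExcision`): **first/last visit decomposition.**  A walk `p : u → v` meeting the vertex set `T`
splits as `p = P · M · S` with `P : u → t₁`, `M : t₁ → t₂`, `S : t₂ → v`, `t₁, t₂ ∈ T`, every vertex
`y ≠ t₁` of `P` joined to `u` by a walk off `T` and every vertex `y ≠ t₂` of `S` joined to `v` by a walk
off `T` (`exists_firstVisit` for `p`, then for the reverse of the remainder). [folklore] -/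
theorem gateExcision_walkDecomp :
    ∀ {V : Type*} {G : SimpleGraph V} (T : Set V) {u v : V} (p : G.Walk u v),
      (∃ y ∈ p.support, y ∈ T) →
      ∃ (t₁ t₂ : V) (P : G.Walk u t₁) (M : G.Walk t₁ t₂) (S : G.Walk t₂ v),
        p = P.append (M.append S) ∧ t₁ ∈ T ∧ t₂ ∈ T ∧
        (∀ y ∈ P.support, y ≠ t₁ → ∃ r : G.Walk u y, ∀ z ∈ r.support, z ∉ T) ∧
        (∀ y ∈ S.support, y ≠ t₂ → ∃ r : G.Walk v y, ∀ z ∈ r.support, z ∉ T) := by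
  intro V G T u v p hp
  obtain ⟨t₁, P, Q, ht₁, hpq, hP⟩ := exists_firstVisit T p hp
  have hQ : ∃ y ∈ Q.reverse.support, y ∈ T := ⟨t₁, Q.reverse.end_mem_support, ht₁⟩
  obtain ⟨t₂, S', M', ht₂, hqs, hS⟩ := exists_firstVisit T Q.reverse hQ
  refine ⟨t₁, t₂, P, M'.reverse, S'.reverse, ?_, ht₁, ht₂, hP, fun y hy hne => ?_⟩
  · rw [hpq, ← SimpleGraph.Walk.reverse_append, ← hqs, SimpleGraph.Walk.reverse_reverse]
  · rw [SimpleGraph.Walk.support_reverse, List.mem_reverse] at hy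
    exact hS y hy hne

/-! ### A self-avoiding prefix is determined by the walk -/

/-- For a self-avoiding walk `p : u → v`, cutting at (the first visit of) its endpoint `v` returns `p`
itself. [folklore] -/
theorem takeUntil_end_of_isPath [DecidableEq V] {u v : V} (p : G.Walk u v) (hp : p.IsPath) :
    p.takeUntil v p.end_mem_support = p := by
  have h1 := p.take_spec p.end_mem_support
  have h2 : p.dropUntil v p.end_mem_support = SimpleGraph.Walk.nil :=
    SimpleGraph.Walk.eq_nil_iff_nil.2 (SimpleGraph.Walk.isPath_iff_nil.1 (hp.dropUntil _))
  rwa [h2, SimpleGraph.Walk.append_nil] at h1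

/-- **A self-avoiding prefix is determined by the walk.**  If `p · q = p' · q'` with `p, p' : u → v`
both self-avoiding, then `p = p'` and `q = q'` (both prefixes are `takeUntil v` of the common walk,
`takeUntil_append_of_mem_left`; then cancel on the left). [folklore] -/
theorem append_inj_of_isPath {u v w : V} {p p' : G.Walk u v} {q q' : G.Walk v w}
    (hp : p.IsPath) (hp' : p'.IsPath) (h : p.append q = p'.append q') : p = p' ∧ q = q' := by
  classical
  have key : ∀ {r r' : G.Walk u w}, r = r' → ∀ (h₁ : v ∈ r.support) (h₂ : v ∈ r'.support),
      r.takeUntil v h₁ = r'.takeUntil v h₂ := by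
    rintro r _ rfl h₁ h₂
    rfl
  have hpp' : p = p' := by
    rw [← takeUntil_end_of_isPath p hp, ← takeUntil_end_of_isPath p' hp',
      ← SimpleGraph.Walk.takeUntil_append_of_mem_left p q p.end_mem_support,
      ← SimpleGraph.Walk.takeUntil_append_of_mem_left p' q' p'.end_mem_support]
    exact key h _ _
  subst hpp'
  exact ⟨rfl, append_left_cancel p h⟩

/-- **Injectivity of the excision bookkeeping.**  If `P · X · S = P' · X · S'` with `P, P'` self-avoiding
(same middle piece `X`), then `P = P'` and `S = S'`. [folklore] -/
theorem append_append_inj_of_isPath {u t₁ t₂ v : V} {P P' : G.Walk u t₁} {X : G.Walk t₁ t₂}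
    {S S' : G.Walk t₂ v} (hP : P.IsPath) (hP' : P'.IsPath)
    (h : P.append (X.append S) = P'.append (X.append S')) : P = P' ∧ S = S' := by
  obtain ⟨hPP', hXS⟩ := append_inj_of_isPath hP hP' h
  exact ⟨hPP', append_left_cancel X hXS⟩

end Summit.CriticalPhenomena.SAWScalingLimit.Theorems.FKGToTraversalBound.GatesByBubbleDoorsByFKG
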